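import Literature.Topology.FourManifolds.LatticeFormsOrthogonalGroupFourU
import Literature.Topology.FourManifolds.LatticeFormsPrimitiveOrbit
import HarnessLib

/-!
# `O⁺(U^{⊕n}) = ⟨σ_r : r² = −2⟩`, `O(U^{⊕n}) = ⟨σ_r : r² = ±2⟩` (Kneser, Wall) and `[O(U^{⊕n}), O(U^{⊕n})] = SO⁺(U^{⊕n})` perfect,
# for ALL `n ≥ 3`, in the tree's standard model `hyperbolicSum n`
# (Gritsenko–Hulek–Sankaran 2009 Thm. 1.1, Thm. 1.7, §3 "SO⁺(L) = ⟨E_U(L₁), SO⁺(L₁)⟩"; Wall 1962 via Markman 2023 §5.1)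

Trunk T-4MAN vocabulary. Rows g49-#7/#13/#14 settled `3U` and `4U`; this file runs GHS's induction "`L = L₁ ⊕ U`,
`O(L) = ⟨E_U(L₁), O(L₁)⟩`" over the whole family `U^{⊕n} = hyperbolicSum n`, `n ≥ 3`, for the three PAIR-FREE statements
(reflection generation of `O⁺`, of `O`, and `[O, O] = SO⁺`): the inductive step is proved for an arbitrary even core `Q` with two
orthogonal hyperbolic pairs (§2: every `φ ∈ O(Q ⊕ H)` is `(ψ ⊕ 1)·ρ` with `ρ ∈ E_U` a word of transvections —
`exists_eq_prodCongr_trans_transvectionAEquiv_trans_evalEquiv` — the `E_U`-part is a word in `(−2)`-reflections / commutators by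
rows g49-#8 / #6, and `ψ ⊕ 1` inherits words from `ψ` (§1)), and the passage `hyperbolicSum (n+1) ≅ hyperbolicSum n ⊕ H` is the
classification isometry `hyperbolicSum_succ_equivalent_prod_hyperbolicForm` with the transport of row g49-#13. Written for lane
`lit-hodgefound` (Track 2 foundations; prover seat `lit-hodgefound-p18`, gen 49, row g49-#15). THEOREMS ONLY — no definition, no
named fact, no instance, no notation.

## Sources, verbatim

* GHS 2009 (held `paper:arxiv-0810.1614`): p. 3 Thm. 1.1 ([Kn1]: "`O′(L)` is generated by the products of reflections `σ_aσ_b` where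
  `a² = b² = −2`"), p. 4 Thm. 1.7 ("`S̃O⁺(L)^{ab}` is trivial"), p. 7 ("it follows that `O(L) = ⟨E_U(L₁), O(L₁)⟩`"-type use of
  Prop. 3.3 in Prop. 3.4: "`g ∈ ⟨E_U(L₁), E_{U₁}(L^{(2)})⟩`. Proceeding in this way we can replace `g` by `g ∈ O(U ⊕ U₁)`"),
  p. 5 (t4) "`g t(e,a) g⁻¹ = t(g(e), g(a))`", "`γσ_rγ⁻¹ = σ_{γ(r)}`".
* Markman 2023 §5.1 (held `paper:arxiv-1805.11574` p. 14): "`O(V)` is generated by the reflections `−ρ(v)` […] `(v,v)_V = ±2`, by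
  [wall]" (`V ≅ U^{⊕4}`; [wall] = Wall, Math. Ann. 147 (1962)).

## Contents (all proved)

* §1 `ψ ↦ ψ ⊕ 1` carries words to words (`IsWordIn.prodCongr_refl_of_set`), reflection words to reflection words
  (`IsWordIn.reflections_prodCongr_refl`), commutator words to commutator words (`IsWordIn.commutators_prodCongr_refl`).
* §2 the pair-free inductive steps over an even core `Q`: `O⁺(Q) ⊆ ⟨σ : −2⟩ ⟹ O⁺(Q ⊕ H) ⊆ ⟨σ : −2⟩`
  (`isWordIn_negTwoReflections_prod_of_forall`), `SO⁺(Q) ⊆ ⟨commutators⟩ ⟹ SO⁺(Q ⊕ H) ⊆ ⟨commutators⟩`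
  (`isWordIn_commutators_prod_of_forall`).
* §3 for all `n ≥ 3`: `hyperbolicSum_isWordIn_negTwoReflections_iff` (`O⁺(U^{⊕n}) = ⟨σ_r : r² = −2⟩`),
  `hyperbolicSum_isWordIn_reflections` (Wall: `O(U^{⊕n}) = ⟨σ_r : r² = ±2⟩`), `hyperbolicSum_isWordIn_commutators_iff`
  (`[O(U^{⊕n}), O(U^{⊕n})] = SO⁺(U^{⊕n})`, perfect), and the same for every lattice isometric to `U^{⊕n}`.
* §5 (appended) the genus `II_{n,n}`, `n ≥ 3`, hypothesis-style: for every even unimodular `B` of rank `2n` and signature `0`,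
  `isWordIn_negTwoReflections_iff_isOrientationPreserving_of_isUnimodular_of_isEven`, `isWordIn_reflections_of_isUnimodular_of_isEven`,
  `isWordIn_commutators_iff_of_isUnimodular_of_isEven`.
-/

noncomputable section

open Module
open LinearMap (BilinForm)
open LinearMap.BilinForm
open LinearMap.BilinForm (IsometryEquiv)

namespace Literature.Topology.FourManifolds

/-! ### §1 `ψ ↦ ψ ⊕ 1` on words -/

section ProdCongr

variable {V N : Type*} [AddCommGroup V] [AddCommGroup N] {Q : BilinForm ℤ V} {S : BilinForm ℤ N}

/-- **`ψ ↦ ψ ⊕ 1_S` maps words to words**: a word in `T ⊆ O(Q)` gives a word in `{s ⊕ 1 : s ∈ T} ⊆ O(Q ⊕ S)`.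
[cite: GritsenkoHulekSankaran2009, §3 ("O(L₁) embedded in O(L)", L = L₁ ⊕ U)] -/
theorem IsWordIn.prodCongr_refl_of_set {T : Set (Q.IsometryEquiv Q)} {ψ : Q.IsometryEquiv Q} (hψ : IsWordIn T ψ) :
    IsWordIn {χ : (Q.prod S).IsometryEquiv (Q.prod S) | ∃ s ∈ T,
      χ = LinearMap.BilinForm.IsometryEquiv.prodCongr s (LinearMap.BilinForm.IsometryEquiv.refl S)}
      (LinearMap.BilinForm.IsometryEquiv.prodCongr ψ (LinearMap.BilinForm.IsometryEquiv.refl S)) := by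
  refine hψ.induction_on (P := fun χ ↦ IsWordIn {χ' : (Q.prod S).IsometryEquiv (Q.prod S) | ∃ s ∈ T,
      χ' = LinearMap.BilinForm.IsometryEquiv.prodCongr s (LinearMap.BilinForm.IsometryEquiv.refl S)}
      (LinearMap.BilinForm.IsometryEquiv.prodCongr χ (LinearMap.BilinForm.IsometryEquiv.refl S)))
    (fun s hs ↦ IsWordIn.of_mem ⟨s, hs, rfl⟩) (IsWordIn.refl.congr fun v ↦ rfl) (fun α β hα hβ ↦ (hα.trans hβ).congr fun v ↦ rfl)
    (fun α hα ↦ hα.symm.congr fun v ↦ rfl)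

/-- `(σ_r ⊕ 1) = σ_{(r,0)}` pointwise. [cite: GritsenkoHulekSankaran2009, §3.1 ("γσ_rγ⁻¹ = σ_{γ(r)}")] -/
theorem normTwoReflectionEquiv_prodCongr_refl_apply (hQ : Q.IsSymm) (hS : S.IsSymm) {r : V} {ε : ℤ} (hr : Q r r = ε + ε)
    (hε : ε * ε = 1) (hr' : (Q.prod S) (r, 0) (r, 0) = ε + ε) (v : V × N) :
    LinearMap.BilinForm.IsometryEquiv.prodCongr (normTwoReflectionEquiv hQ r ε hr hε) (LinearMap.BilinForm.IsometryEquiv.refl S) v =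
      normTwoReflectionEquiv (hQ.prod hS) (r, 0) ε hr' hε v := by
  rw [LinearMap.BilinForm.IsometryEquiv.prodCongr_apply, normTwoReflectionEquiv_apply, normTwoReflectionEquiv_apply,
    LinearMap.BilinForm.IsometryEquiv.refl_apply, LinearMap.BilinForm.prod_apply, map_zero, LinearMap.zero_apply, add_zero]
  ext <;> simp

/-- **Reflection words pass to `Q ⊕ S`**: if `ψ` is a word in `{σ_r : Q(r,r) = 2ε}` then `ψ ⊕ 1` is a word in
`{σ_{r′} : (Q ⊕ S)(r′,r′) = 2ε}`. [cite: GritsenkoHulekSankaran2009, §3.1 and Thm. 1.1] -/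
theorem IsWordIn.reflections_prodCongr_refl (hQ : Q.IsSymm) (hS : S.IsSymm) {ε : ℤ} (hε : ε * ε = 1) {ψ : Q.IsometryEquiv Q}
    (hψ : IsWordIn {χ : Q.IsometryEquiv Q | ∃ (r : V) (hr : Q r r = ε + ε), χ = normTwoReflectionEquiv hQ r ε hr hε} ψ) :
    IsWordIn {χ : (Q.prod S).IsometryEquiv (Q.prod S) | ∃ (r : V × N) (hr : (Q.prod S) r r = ε + ε),
        χ = normTwoReflectionEquiv (hQ.prod hS) r ε hr hε}
      (LinearMap.BilinForm.IsometryEquiv.prodCongr ψ (LinearMap.BilinForm.IsometryEquiv.refl S)) := by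
  refine hψ.prodCongr_refl_of_set.bind fun s hs ↦ ?_
  obtain ⟨s', ⟨r, hr, rfl⟩, rfl⟩ := hs
  have hr' : (Q.prod S) (r, 0) (r, 0) = ε + ε := by
    rw [LinearMap.BilinForm.prod_apply]
    simp [hr]
  exact IsWordIn.congr (IsWordIn.of_mem (φ := normTwoReflectionEquiv (hQ.prod hS) (r, 0) ε hr' hε) ⟨(r, 0), hr', rfl⟩)
    fun v ↦ (normTwoReflectionEquiv_prodCongr_refl_apply hQ hS hr hε hr' v).symm

/-- **Commutator words pass to `Q ⊕ S`**: `[α,β] ⊕ 1 = [α ⊕ 1, β ⊕ 1]`. [cite: GritsenkoHulekSankaran2009, Cor. 1.8 and §3] -/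
theorem IsWordIn.commutators_prodCongr_refl {ψ : Q.IsometryEquiv Q}
    (hψ : IsWordIn {χ : Q.IsometryEquiv Q | ∃ α β : Q.IsometryEquiv Q, χ = ((β.symm.trans α.symm).trans β).trans α} ψ) :
    IsWordIn {χ : (Q.prod S).IsometryEquiv (Q.prod S) | ∃ α β : (Q.prod S).IsometryEquiv (Q.prod S),
        χ = ((β.symm.trans α.symm).trans β).trans α}
      (LinearMap.BilinForm.IsometryEquiv.prodCongr ψ (LinearMap.BilinForm.IsometryEquiv.refl S)) := by
  refine hψ.prodCongr_refl_of_set.bind fun s hs ↦ ?_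
  obtain ⟨s', ⟨α, β, rfl⟩, rfl⟩ := hs
  exact IsWordIn.congr (IsWordIn.of_mem
    (φ := (((LinearMap.BilinForm.IsometryEquiv.prodCongr β (LinearMap.BilinForm.IsometryEquiv.refl S)).symm.trans
        (LinearMap.BilinForm.IsometryEquiv.prodCongr α (LinearMap.BilinForm.IsometryEquiv.refl S)).symm).trans
        (LinearMap.BilinForm.IsometryEquiv.prodCongr β (LinearMap.BilinForm.IsometryEquiv.refl S))).trans
        (LinearMap.BilinForm.IsometryEquiv.prodCongr α (LinearMap.BilinForm.IsometryEquiv.refl S)))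
    ⟨LinearMap.BilinForm.IsometryEquiv.prodCongr α (LinearMap.BilinForm.IsometryEquiv.refl S),
      LinearMap.BilinForm.IsometryEquiv.prodCongr β (LinearMap.BilinForm.IsometryEquiv.refl S), rfl⟩) fun v ↦ rfl

end ProdCongr

/-! ### §2 The pair-free inductive steps over an even core `Q` -/

section Step

variable {V : Type} [AddCommGroup V] [Module.Finite ℤ V] [Module.Free ℤ V] {Q : BilinForm ℤ V} {x₁ y₁ x₂ y₂ r : V}

/-- **`O⁺(L₁) ⊆ ⟨σ : −2⟩ ⟹ O⁺(L₁ ⊕ U) ⊆ ⟨σ : −2⟩`** for an even non-degenerate core `L₁ = Q` containing a hyperbolic pair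
`(x₁, y₁)` and a `(−2)`-vector `r ⊥ x₁, y₁`: every `φ ∈ O(Q ⊕ H)` is `(ψ ⊕ 1)·ρ` with `ρ ∈ E_U(L₁) ⊆ S̃O⁺` a word of
transvections (so `ψ ∈ O⁺(Q)` when `φ ∈ O⁺`), the transvections are words in `(−2)`-reflections by (t6), and `ψ ⊕ 1` is one by
hypothesis. [cite: GritsenkoHulekSankaran2009, Thm. 1.1, §3.1 (t6) and §3.3 (proof of Prop. 3.4: "g ∈ ⟨E_U(L₁), …⟩")] -/
theorem isWordIn_negTwoReflections_prod_of_forall (hQ : Q.IsSymm) (hev : Q.IsEven) (hndQ : Q.Nondegenerate)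
    (hx₁ : Q x₁ x₁ = 0) (hy₁ : Q y₁ y₁ = 0) (hx₁y₁ : Q x₁ y₁ = 1) (hx₁r : Q x₁ r = 0) (hy₁r : Q y₁ r = 0)
    (hrr : Q r r = -1 + -1)
    (IH : ∀ ψ : Q.IsometryEquiv Q, ψ.IsOrientationPreserving →
      IsWordIn {χ : Q.IsometryEquiv Q | ∃ (s : V) (hs : Q s s = -1 + -1), χ = normTwoReflectionEquiv hQ s (-1) hs (by norm_num)} ψ)
    (φ : (Q.prod hyperbolicForm).IsometryEquiv (Q.prod hyperbolicForm)) (h₁ : φ.IsOrientationPreserving) :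
    IsWordIn {χ : (Q.prod hyperbolicForm).IsometryEquiv (Q.prod hyperbolicForm) | ∃ (s : V × (Fin 2 → ℤ))
        (hs : (Q.prod hyperbolicForm) s s = -1 + -1), χ = normTwoReflectionEquiv (hQ.prod isSymm_hyperbolicForm) s (-1) hs
          (by norm_num)} φ := by
  have hB : (Q.prod hyperbolicForm).IsSymm := hQ.prod isSymm_hyperbolicForm
  have hnd : (Q.prod hyperbolicForm).Nondegenerate := hndQ.prod isUnimodular_hyperbolicForm_holds.nondegenerate
  obtain ⟨l, hl, a, q, hq, ψ, hφ⟩ := exists_eq_prodCongr_trans_transvectionAEquiv_trans_evalEquiv hQ hev hx₁ hy₁ hx₁y₁ φ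
  set ρ := (transvectionAEquiv hQ a q hq).trans (UGen.evalEquiv hB (prod_hyperbolic_hypX_hypX Q)
    (prod_hyperbolic_hypY_hypY Q) l hl) with hρ
  have hφ' : φ = (LinearMap.BilinForm.IsometryEquiv.prodCongr ψ
      (LinearMap.BilinForm.IsometryEquiv.refl hyperbolicForm)).trans ρ := by
    rw [hφ]
    rfl
  have hρS := mem_stableSpecialOrthogonal_trans hB hnd (transvectionAEquiv_mem_stableSpecialOrthogonal hQ hnd a q hq)
    (UGen.evalEquiv_mem_stableSpecialOrthogonal hB hnd (prod_hyperbolic_hypX_hypX Q) (prod_hyperbolic_hypY_hypY Q) l hl)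
  have hψ₁ : ψ.IsOrientationPreserving :=
    (isOrientationPreserving_iff_of_eq_prodCongr_refl_trans hQ hndQ hnd hφ' hρS.2.1).1 h₁
  -- `ρ` is the admissible word `l ++ [A_a]`, a word in `(−2)`-reflections
  have hl' : ∀ g ∈ l ++ [UGen.atY ((a, 0) : V × (Fin 2 → ℤ)) q], g.IsAdmissible (Q.prod hyperbolicForm) hypX hypY := by
    intro g hg
    rcases List.mem_append.1 hg with hg | hg
    · exact hl g hg
    · rw [List.mem_singleton] at hg
      subst hg
      exact ⟨prod_hyperbolic_hypX_inl Q a, prod_hyperbolic_hypY_inl Q a, by rw [prod_hyperbolic_inl_inl, hq]⟩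
  have P₁ := twoHyperbolicPairs_prod_hyperbolic hQ hx₁ hy₁ hx₁y₁
  have hρw := isWordIn_reflections_evalEquiv P₁ (ε := -1) (r := ((r, 0) : V × (Fin 2 → ℤ))) (by norm_num)
    (prod_hyperbolic_hypX_inl Q r) (prod_hyperbolic_hypY_inl Q r) (by rw [prod_hyperbolic_inl_inl, hx₁r])
    (by rw [prod_hyperbolic_inl_inl, hy₁r]) (by rw [prod_hyperbolic_inl_inl, hrr]) _ hl'
  have hρeq : ∀ v, UGen.evalEquiv hB (prod_hyperbolic_hypX_hypX Q) (prod_hyperbolic_hypY_hypY Q)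
      (l ++ [UGen.atY ((a, 0) : V × (Fin 2 → ℤ)) q]) hl' v = ρ v := fun v ↦ by
    rw [hρ, LinearMap.BilinForm.IsometryEquiv.trans_apply, UGen.evalEquiv_apply, UGen.evalEquiv_apply, UGen.eval_append,
      LinearMap.comp_apply, UGen.eval_cons, UGen.eval_nil, LinearMap.comp_apply, LinearMap.id_apply, transvectionAEquiv_apply]
    rfl
  have hψw := (IH ψ hψ₁).reflections_prodCongr_refl hQ isSymm_hyperbolicForm (S := hyperbolicForm) (by norm_num)
  rw [hφ']
  exact hψw.trans (hρw.congr hρeq)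

/-- **`SO⁺(L₁) ⊆ ⟨commutators⟩ ⟹ SO⁺(L₁ ⊕ U) ⊆ ⟨commutators⟩`** for an even non-degenerate core `L₁ = Q` containing two
orthogonal hyperbolic pairs: `φ = (ψ ⊕ 1)·ρ`, `ρ ∈ E_U(L₁)` is a word in commutators as soon as `L₁` contains two hyperbolic
planes (row g49-#6), and `ψ ∈ SO⁺(Q)`. [cite: GritsenkoHulekSankaran2009, Thm. 1.7, §3.3 and §4.1] -/
theorem isWordIn_commutators_prod_of_forall (hQ : Q.IsSymm) (hev : Q.IsEven) (hndQ : Q.Nondegenerate)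
    (h₁₂ : TwoHyperbolicPairs Q x₁ y₁ x₂ y₂)
    (IH : ∀ ψ : Q.IsometryEquiv Q, ψ.IsOrientationPreserving → LinearMap.det (ψ : V →ₗ[ℤ] V) = 1 →
      IsWordIn {χ : Q.IsometryEquiv Q | ∃ α β : Q.IsometryEquiv Q, χ = ((β.symm.trans α.symm).trans β).trans α} ψ)
    (φ : (Q.prod hyperbolicForm).IsometryEquiv (Q.prod hyperbolicForm)) (h₁ : φ.IsOrientationPreserving)
    (h₂ : LinearMap.det (φ : V × (Fin 2 → ℤ) →ₗ[ℤ] V × (Fin 2 → ℤ)) = 1) :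
    IsWordIn {χ : (Q.prod hyperbolicForm).IsometryEquiv (Q.prod hyperbolicForm) |
        ∃ α β : (Q.prod hyperbolicForm).IsometryEquiv (Q.prod hyperbolicForm), χ = ((β.symm.trans α.symm).trans β).trans α} φ := by
  have hB : (Q.prod hyperbolicForm).IsSymm := hQ.prod isSymm_hyperbolicForm
  have hnd : (Q.prod hyperbolicForm).Nondegenerate := hndQ.prod isUnimodular_hyperbolicForm_holds.nondegenerate
  obtain ⟨l, hl, a, q, hq, ψ, hφ⟩ :=
    exists_eq_prodCongr_trans_transvectionAEquiv_trans_evalEquiv hQ hev h₁₂.xx h₁₂.yy h₁₂.xy φ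
  set ρ := (transvectionAEquiv hQ a q hq).trans (UGen.evalEquiv hB (prod_hyperbolic_hypX_hypX Q)
    (prod_hyperbolic_hypY_hypY Q) l hl) with hρ
  have hφ' : φ = (LinearMap.BilinForm.IsometryEquiv.prodCongr ψ
      (LinearMap.BilinForm.IsometryEquiv.refl hyperbolicForm)).trans ρ := by
    rw [hφ]
    rfl
  have hρS := mem_stableSpecialOrthogonal_trans hB hnd (transvectionAEquiv_mem_stableSpecialOrthogonal hQ hnd a q hq)
    (UGen.evalEquiv_mem_stableSpecialOrthogonal hB hnd (prod_hyperbolic_hypX_hypX Q) (prod_hyperbolic_hypY_hypY Q) l hl)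
  have hψ₁ : ψ.IsOrientationPreserving :=
    (isOrientationPreserving_iff_of_eq_prodCongr_refl_trans hQ hndQ hnd hφ' hρS.2.1).1 h₁
  have hψ₂ : LinearMap.det (ψ : V →ₗ[ℤ] V) = 1 := by
    rw [← det_eq_of_eq_prodCongr_refl_trans hφ' hρS.2.2]
    exact h₂
  have hl' : ∀ g ∈ l ++ [UGen.atY ((a, 0) : V × (Fin 2 → ℤ)) q], g.IsAdmissible (Q.prod hyperbolicForm) hypX hypY := by
    intro g hg
    rcases List.mem_append.1 hg with hg | hg
    · exact hl g hg
    · rw [List.mem_singleton] at hg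
      subst hg
      exact ⟨prod_hyperbolic_hypX_inl Q a, prod_hyperbolic_hypY_inl Q a, by rw [prod_hyperbolic_inl_inl, hq]⟩
  have P₁ := twoHyperbolicPairs_prod_hyperbolic hQ h₁₂.xx h₁₂.yy h₁₂.xy
  have P₂ := twoHyperbolicPairs_prod_hyperbolic hQ h₁₂.x₁x₁ h₁₂.y₁y₁ h₁₂.x₁y₁
  have P₁₂ := h₁₂.inl isSymm_hyperbolicForm
  have hρw := isWordIn_commutators_evalEquiv P₁ P₂ P₁₂ (isEven_prod_hyperbolic hev)
    (C := {χ : (Q.prod hyperbolicForm).IsometryEquiv (Q.prod hyperbolicForm) |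
      ∃ α β : (Q.prod hyperbolicForm).IsometryEquiv (Q.prod hyperbolicForm), χ = ((β.symm.trans α.symm).trans β).trans α})
    (fun l₁ l₂ hl₁ hl₂ ↦ by exact ⟨_, _, rfl⟩) _ hl'
  have hρeq : ∀ v, UGen.evalEquiv hB (prod_hyperbolic_hypX_hypX Q) (prod_hyperbolic_hypY_hypY Q)
      (l ++ [UGen.atY ((a, 0) : V × (Fin 2 → ℤ)) q]) hl' v = ρ v := fun v ↦ by
    rw [hρ, LinearMap.BilinForm.IsometryEquiv.trans_apply, UGen.evalEquiv_apply, UGen.evalEquiv_apply, UGen.eval_append,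
      LinearMap.comp_apply, UGen.eval_cons, UGen.eval_nil, LinearMap.comp_apply, LinearMap.id_apply, transvectionAEquiv_apply]
    rfl
  have hψw := (IH ψ hψ₁ hψ₂).commutators_prodCongr_refl (S := hyperbolicForm)
  rw [hφ']
  exact hψw.trans (hρw.congr hρeq)

end Step

/-! ### §3 All `U^{⊕n}`, `n ≥ 3` -/

section HyperbolicSum

/-- Basis values of `hyperbolicSum n` used below: for `i ≠ j`, the vector `e_j − f_j` has norm `−2`, `e_j + f_j` has norm `2`, and
both are orthogonal to `e_i`, `f_i`. [cite: Huybrechts2016K3, Ch. 14 §0.3 (ii)] -/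
theorem hyperbolicSum_root_values {n : ℕ} {i j : Fin n} (hij : i ≠ j) (ε : ℤ) :
    hyperbolicSum n ((Pi.single j 1, ε • Pi.single j 1) : (Fin n → ℤ) × (Fin n → ℤ)) (Pi.single j 1, ε • Pi.single j 1) = ε + ε ∧
    hyperbolicSum n ((Pi.single i 1, 0) : (Fin n → ℤ) × (Fin n → ℤ)) (Pi.single j 1, ε • Pi.single j 1) = 0 ∧
    hyperbolicSum n ((0, Pi.single i 1) : (Fin n → ℤ) × (Fin n → ℤ)) (Pi.single j 1, ε • Pi.single j 1) = 0 := by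
  refine ⟨?_, ?_, ?_⟩
  · rw [hyperbolicSum_apply]
    simp
  · rw [hyperbolicSum_apply]
    simp [hij]
  · rw [hyperbolicSum_apply]
    simp [hij]

/-- **Kneser / GHS Thm. 1.1 for all `U^{⊕n}`, `n ≥ 3`: `O⁺(U^{⊕n})` is generated by the `(−2)`-reflections** — an isometry of
`hyperbolicSum n` is a word in `{σ_r : (r,r) = −2}` iff it preserves the orientation of the positive `n`-space (induction on `n`
from `3U` along `U^{⊕(n+1)} ≅ U^{⊕n} ⊕ U`). [cite: GritsenkoHulekSankaran2009, Thm. 1.1 and §3.3–§4] -/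
theorem hyperbolicSum_isWordIn_negTwoReflections_iff {n : ℕ} (hn : 3 ≤ n) :
    ∀ φ : (hyperbolicSum n).IsometryEquiv (hyperbolicSum n),
      IsWordIn {ψ : (hyperbolicSum n).IsometryEquiv (hyperbolicSum n) | ∃ (r : (Fin n → ℤ) × (Fin n → ℤ))
          (hr : hyperbolicSum n r r = -1 + -1), ψ = normTwoReflectionEquiv (isSymm_hyperbolicSum n) r (-1) hr (by norm_num)} φ ↔
        φ.IsOrientationPreserving := by
  induction n, hn using Nat.le_induction with
  | base => exact hyperbolicSum_three_isWordIn_negTwoReflections_iff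
  | succ n hn ih =>
    intro φ'
    have hB' := isSymm_hyperbolicSum (n + 1)
    have hnd' := (isUnimodular_hyperbolicSum (n + 1)).nondegenerate
    refine ⟨fun h ↦ (IsWordIn.isOrientationPreserving_and_congr_eq_refl_of_negTwoReflections _ hB' hnd' (fun s hs ↦ hs) h).1,
      fun h₁ ↦ ?_⟩
    obtain ⟨e₀⟩ := hyperbolicSum_succ_equivalent_prod_hyperbolicForm n
    have hQ := isSymm_hyperbolicSum n
    have hB : ((hyperbolicSum n).prod hyperbolicForm).IsSymm := hQ.prod isSymm_hyperbolicForm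
    have hi : (⟨0, by omega⟩ : Fin n) ≠ ⟨1, by omega⟩ := by simp [Fin.ext_iff]
    have P := twoHyperbolicPairs_hyperbolicSum (n := n) hi
    obtain ⟨hrr, hxr, hyr⟩ := hyperbolicSum_root_values hi (-1)
    have hφ : (e₀.symm.trans (φ'.trans e₀.symm.symm)).IsOrientationPreserving :=
      (LinearMap.BilinForm.IsometryEquiv.isOrientationPreserving_trans_trans_symm_iff e₀.symm φ').2 h₁
    have hw := isWordIn_negTwoReflections_prod_of_forall hQ (isEven_hyperbolicSum n) (isUnimodular_hyperbolicSum n).nondegenerate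
      P.xx P.yy P.xy hxr hyr hrr (fun ψ hψ ↦ (ih ψ).2 hψ) _ hφ
    exact (hw.negTwoReflections_conj hB hB' e₀.symm).congr fun v ↦
      IsometryEquiv.symm_trans_trans_trans_symm_trans_apply e₀.symm φ' v

/-- **Wall's theorem for all `U^{⊕n}`, `n ≥ 3`: `O(U^{⊕n})` is generated by the reflections in `(±2)`-vectors.**
[cite: Markman2023GeneralizedKummers, §5.1 ("O(V) is generated by the reflections −ρ(v) … (v,v)_V = ±2, by [wall]")] [cite: Wall1962OrthogonalGroups] [cite: GritsenkoHulekSankaran2009, Thm. 1.1] -/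
theorem hyperbolicSum_isWordIn_reflections {n : ℕ} (hn : 3 ≤ n) (φ : (hyperbolicSum n).IsometryEquiv (hyperbolicSum n)) :
    IsWordIn {ψ : (hyperbolicSum n).IsometryEquiv (hyperbolicSum n) | ∃ (r : (Fin n → ℤ) × (Fin n → ℤ)) (ε : ℤ) (hε : ε * ε = 1)
        (hr : hyperbolicSum n r r = ε + ε), ψ = normTwoReflectionEquiv (isSymm_hyperbolicSum n) r ε hr hε} φ := by
  have hB := isSymm_hyperbolicSum n
  have hnd := (isUnimodular_hyperbolicSum n).nondegenerate
  by_cases h₁ : φ.IsOrientationPreserving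
  · refine ((hyperbolicSum_isWordIn_negTwoReflections_iff hn φ).2 h₁).mono fun ψ hψ ↦ ?_
    obtain ⟨r, hr, h⟩ := hψ
    exact ⟨r, -1, by norm_num, hr, h⟩
  · -- the `(+2)`-reflection `σ₊ = σ_{e₀ + f₀} ∉ O⁺`, `φσ₊ ∈ O⁺`, `φ = (φσ₊)σ₊`
    obtain ⟨r, hw⟩ : ∃ r : (Fin n → ℤ) × (Fin n → ℤ), hyperbolicSum n r r = 1 + 1 := by
      have hi : (⟨1, by omega⟩ : Fin n) ≠ ⟨0, by omega⟩ := by simp [Fin.ext_iff]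
      exact ⟨_, (hyperbolicSum_root_values hi 1).1⟩
    have hσO : ¬ (normTwoReflectionEquiv hB r 1 hw (by norm_num)).IsOrientationPreserving := by
      rw [isOrientationPreserving_normTwoReflectionEquiv_iff _ hB hnd _ 1 hw (by norm_num)]
      norm_num
    have hφσ := (hyperbolicSum_isWordIn_negTwoReflections_iff hn (φ.trans (normTwoReflectionEquiv hB r 1 hw (by norm_num)))).2
      ((LinearMap.BilinForm.IsometryEquiv.isOrientationPreserving_trans_iff hB hnd φ _).2 (iff_of_false hσO h₁))
    have hφσ' : IsWordIn {ψ : (hyperbolicSum n).IsometryEquiv (hyperbolicSum n) | ∃ (r : (Fin n → ℤ) × (Fin n → ℤ)) (ε : ℤ)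
        (hε : ε * ε = 1) (hr : hyperbolicSum n r r = ε + ε), ψ = normTwoReflectionEquiv hB r ε hr hε}
        (φ.trans (normTwoReflectionEquiv hB r 1 hw (by norm_num))) := by
      refine hφσ.mono fun ψ hψ ↦ ?_
      obtain ⟨r, hr, h⟩ := hψ
      exact ⟨r, -1, by norm_num, hr, h⟩
    have hσmem : normTwoReflectionEquiv hB r 1 hw (by norm_num) ∈ {ψ : (hyperbolicSum n).IsometryEquiv (hyperbolicSum n) |
        ∃ (r : (Fin n → ℤ) × (Fin n → ℤ)) (ε : ℤ) (hε : ε * ε = 1) (hr : hyperbolicSum n r r = ε + ε),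
        ψ = normTwoReflectionEquiv hB r ε hr hε} := ⟨r, 1, by norm_num, hw, rfl⟩
    refine (hφσ'.trans (IsWordIn.of_mem hσmem)).congr fun v ↦ ?_
    rw [LinearMap.BilinForm.IsometryEquiv.trans_apply, LinearMap.BilinForm.IsometryEquiv.trans_apply, normTwoReflectionEquiv_apply,
      normTwoReflectionEquiv_apply]
    have key : ∀ w : (Fin n → ℤ) × (Fin n → ℤ), hyperbolicSum n r (w - ((1 : ℤ) * hyperbolicSum n r w) • r) = - hyperbolicSum n r w :=
      fun w ↦ by
        rw [map_sub, map_smul, smul_eq_mul, hw]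
        ring
    rw [key]
    module

/-- **GHS Thm. 1.7 / Cor. 1.8 for all `U^{⊕n}`, `n ≥ 3`: `[O(U^{⊕n}), O(U^{⊕n})] = SO⁺(U^{⊕n})`** (so `SO⁺(U^{⊕n})` is perfect and
`O(U^{⊕n})^{ab} ≅ (ℤ/2ℤ)²`): an isometry of `hyperbolicSum n` is a word in commutators iff it lies in `O⁺` with `det = 1`.
[cite: GritsenkoHulekSankaran2009, Thm. 1.7, Cor. 1.8 and §3.3–§4] -/
theorem hyperbolicSum_isWordIn_commutators_iff {n : ℕ} (hn : 3 ≤ n) :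
    ∀ φ : (hyperbolicSum n).IsometryEquiv (hyperbolicSum n),
      IsWordIn {ψ : (hyperbolicSum n).IsometryEquiv (hyperbolicSum n) |
          ∃ α β : (hyperbolicSum n).IsometryEquiv (hyperbolicSum n), ψ = ((β.symm.trans α.symm).trans β).trans α} φ ↔
        φ.IsOrientationPreserving ∧ LinearMap.det (φ : (Fin n → ℤ) × (Fin n → ℤ) →ₗ[ℤ] (Fin n → ℤ) × (Fin n → ℤ)) = 1 := by
  induction n, hn using Nat.le_induction with
  | base => exact hyperbolicSum_three_isWordIn_commutators_iff
  | succ n hn ih =>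
    intro φ'
    have hB' := isSymm_hyperbolicSum (n + 1)
    have hnd' := (isUnimodular_hyperbolicSum (n + 1)).nondegenerate
    refine ⟨fun h ↦ IsWordIn.isOrientationPreserving_and_det_eq_one_of_commutators hB' hnd' (fun s hs ↦ hs) h, fun h ↦ ?_⟩
    obtain ⟨e₀⟩ := hyperbolicSum_succ_equivalent_prod_hyperbolicForm n
    have hQ := isSymm_hyperbolicSum n
    have hi : (⟨0, by omega⟩ : Fin n) ≠ ⟨1, by omega⟩ := by simp [Fin.ext_iff]
    have P := twoHyperbolicPairs_hyperbolicSum (n := n) hi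
    have hφ₁ : (e₀.symm.trans (φ'.trans e₀.symm.symm)).IsOrientationPreserving :=
      (LinearMap.BilinForm.IsometryEquiv.isOrientationPreserving_trans_trans_symm_iff e₀.symm φ').2 h.1
    have hφ₂ : LinearMap.det ((e₀.symm.trans (φ'.trans e₀.symm.symm) : ((hyperbolicSum n).prod hyperbolicForm).IsometryEquiv _) :
        ((Fin n → ℤ) × (Fin n → ℤ)) × (Fin 2 → ℤ) →ₗ[ℤ] ((Fin n → ℤ) × (Fin n → ℤ)) × (Fin 2 → ℤ)) = 1 := by
      rw [IsometryEquiv.det_trans_trans_symm, h.2]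
    have hw := isWordIn_commutators_prod_of_forall hQ (isEven_hyperbolicSum n) (isUnimodular_hyperbolicSum n).nondegenerate P
      (fun ψ hψ₁ hψ₂ ↦ (ih ψ).2 ⟨hψ₁, hψ₂⟩) _ hφ₁ hφ₂
    exact (hw.commutators_conj e₀.symm).congr fun v ↦ IsometryEquiv.symm_trans_trans_trans_symm_trans_apply e₀.symm φ' v

end HyperbolicSum

/-! ### §4 Every lattice isometric to `U^{⊕n}`, `n ≥ 3` -/

section Model

variable {W' : Type} [AddCommGroup W'] [Module.Finite ℤ W'] [Module.Free ℤ W'] {B' : BilinForm ℤ W'}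

/-- **`O⁺(L) = ⟨σ_r : r² = −2⟩` for every lattice `L ≅ U^{⊕n}`, `n ≥ 3`.** [cite: GritsenkoHulekSankaran2009, Thm. 1.1] -/
theorem isWordIn_negTwoReflections_iff_isOrientationPreserving_of_isometryEquiv_hyperbolicSum {n : ℕ} (hn : 3 ≤ n)
    (hB' : B'.IsSymm) (hnd' : B'.Nondegenerate) (e : (hyperbolicSum n).IsometryEquiv B') (φ' : B'.IsometryEquiv B') :
    IsWordIn {ψ' : B'.IsometryEquiv B' | ∃ (r : W') (hr : B' r r = -1 + -1), ψ' = normTwoReflectionEquiv hB' r (-1) hr (by norm_num)}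
      φ' ↔ φ'.IsOrientationPreserving := by
  refine ⟨fun h ↦ (IsWordIn.isOrientationPreserving_and_congr_eq_refl_of_negTwoReflections _ hB' hnd' (fun s hs ↦ hs) h).1,
    fun h₁ ↦ ?_⟩
  have hφ : (e.trans (φ'.trans e.symm)).IsOrientationPreserving :=
    (LinearMap.BilinForm.IsometryEquiv.isOrientationPreserving_trans_trans_symm_iff e φ').2 h₁
  have hw := (hyperbolicSum_isWordIn_negTwoReflections_iff hn _).2 hφ
  exact (hw.negTwoReflections_conj (isSymm_hyperbolicSum n) hB' e).congr fun v ↦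
    IsometryEquiv.symm_trans_trans_trans_symm_trans_apply e φ' v

omit [Module.Finite ℤ W'] [Module.Free ℤ W'] in
/-- **Wall: `O(L)` is generated by the reflections in `(±2)`-vectors for every lattice `L ≅ U^{⊕n}`, `n ≥ 3`.**
[cite: Markman2023GeneralizedKummers, §5.1] [cite: Wall1962OrthogonalGroups] -/
theorem isWordIn_reflections_of_isometryEquiv_hyperbolicSum {n : ℕ} (hn : 3 ≤ n) (hB' : B'.IsSymm)
    (e : (hyperbolicSum n).IsometryEquiv B') (φ' : B'.IsometryEquiv B') :
    IsWordIn {ψ' : B'.IsometryEquiv B' | ∃ (r : W') (ε : ℤ) (hε : ε * ε = 1) (hr : B' r r = ε + ε),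
      ψ' = normTwoReflectionEquiv hB' r ε hr hε} φ' :=
  ((hyperbolicSum_isWordIn_reflections hn (e.trans (φ'.trans e.symm))).reflections_conj (isSymm_hyperbolicSum n) hB' e).congr
    fun v ↦ IsometryEquiv.symm_trans_trans_trans_symm_trans_apply e φ' v

/-- **`[O(L), O(L)] = SO⁺(L)` for every lattice `L ≅ U^{⊕n}`, `n ≥ 3`.** [cite: GritsenkoHulekSankaran2009, Thm. 1.7 and Cor. 1.8] -/
theorem isWordIn_commutators_iff_of_isometryEquiv_hyperbolicSum {n : ℕ} (hn : 3 ≤ n) (hB' : B'.IsSymm) (hnd' : B'.Nondegenerate)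
    (e : (hyperbolicSum n).IsometryEquiv B') (φ' : B'.IsometryEquiv B') :
    IsWordIn {ψ' : B'.IsometryEquiv B' | ∃ α β : B'.IsometryEquiv B', ψ' = ((β.symm.trans α.symm).trans β).trans α} φ' ↔
      φ'.IsOrientationPreserving ∧ LinearMap.det (φ' : W' →ₗ[ℤ] W') = 1 := by
  refine ⟨fun h ↦ IsWordIn.isOrientationPreserving_and_det_eq_one_of_commutators hB' hnd' (fun s hs ↦ hs) h, fun h ↦ ?_⟩
  have hφ₁ : (e.trans (φ'.trans e.symm)).IsOrientationPreserving :=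
    (LinearMap.BilinForm.IsometryEquiv.isOrientationPreserving_trans_trans_symm_iff e φ').2 h.1
  have hφ₂ : LinearMap.det ((e.trans (φ'.trans e.symm) : (hyperbolicSum n).IsometryEquiv _) :
      (Fin n → ℤ) × (Fin n → ℤ) →ₗ[ℤ] (Fin n → ℤ) × (Fin n → ℤ)) = 1 := by
    rw [IsometryEquiv.det_trans_trans_symm, h.2]
  have hw := (hyperbolicSum_isWordIn_commutators_iff hn _).2 ⟨hφ₁, hφ₂⟩
  exact (hw.commutators_conj e).congr fun v ↦ IsometryEquiv.symm_trans_trans_trans_symm_trans_apply e φ' v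

end Model

/-! ### §5 Every even unimodular lattice of signature `(n, n)`, `n ≥ 3` (the genus `II_{n,n}`) -/

section EvenUnimodular

variable {W : Type} [AddCommGroup W] [Module.Finite ℤ W] [Module.Free ℤ W] {B : BilinForm ℤ W}

/-- **Kneser for `II_{n,n}`, `n ≥ 3`**: for every even unimodular lattice of rank `2n ≥ 6` and signature `0` (`≅ U^{⊕n}`), `O⁺` is
generated by the `(−2)`-reflections. [cite: GritsenkoHulekSankaran2009, Thm. 1.1] [cite: Huybrechts2016K3, Ch. 14 Cor. 1.3 (i)] -/
theorem isWordIn_negTwoReflections_iff_isOrientationPreserving_of_isUnimodular_of_isEven (hB : B.IsSymm) (hu : B.IsUnimodular)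
    (he : B.IsEven) {n : ℕ} (hn : 3 ≤ n) (hrank : finrank ℤ W = 2 * n) (hsig : B.signature = 0) (φ : B.IsometryEquiv B) :
    IsWordIn {ψ : B.IsometryEquiv B | ∃ (r : W) (hr : B r r = -1 + -1), ψ = normTwoReflectionEquiv hB r (-1) hr (by norm_num)} φ ↔
      φ.IsOrientationPreserving := by
  obtain ⟨e⟩ := equivalent_hyperbolicSum_of_signature_eq_zero _ hB hu he (by omega) hrank hsig
  exact isWordIn_negTwoReflections_iff_isOrientationPreserving_of_isometryEquiv_hyperbolicSum hn hB hu.nondegenerate e.symm φ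

omit [Module.Finite ℤ W] [Module.Free ℤ W] in
/-- **Wall for `II_{n,n}`, `n ≥ 3`**: for every even unimodular lattice of rank `2n ≥ 6` and signature `0`, `O` is generated by the
reflections in `(±2)`-vectors. [cite: Wall1962OrthogonalGroups] [cite: Markman2023GeneralizedKummers, §5.1] [cite: Huybrechts2016K3, Ch. 14 Cor. 1.3 (i)] -/
theorem isWordIn_reflections_of_isUnimodular_of_isEven [Module.Finite ℤ W] [Module.Free ℤ W] (hB : B.IsSymm)
    (hu : B.IsUnimodular) (he : B.IsEven) {n : ℕ} (hn : 3 ≤ n) (hrank : finrank ℤ W = 2 * n) (hsig : B.signature = 0)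
    (φ : B.IsometryEquiv B) :
    IsWordIn {ψ : B.IsometryEquiv B | ∃ (r : W) (ε : ℤ) (hε : ε * ε = 1) (hr : B r r = ε + ε), ψ = normTwoReflectionEquiv hB r ε hr hε}
      φ := by
  obtain ⟨e⟩ := equivalent_hyperbolicSum_of_signature_eq_zero _ hB hu he (by omega) hrank hsig
  exact isWordIn_reflections_of_isometryEquiv_hyperbolicSum hn hB e.symm φ

/-- **GHS Thm. 1.7 / Cor. 1.8 for `II_{n,n}`, `n ≥ 3`**: for every even unimodular lattice of rank `2n ≥ 6` and signature `0`,
`[O, O] = SO⁺` — a word in commutators iff orientation-preserving with `det = 1`.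
[cite: GritsenkoHulekSankaran2009, Thm. 1.7 and Cor. 1.8] [cite: Huybrechts2016K3, Ch. 14 Cor. 1.3 (i)] -/
theorem isWordIn_commutators_iff_of_isUnimodular_of_isEven (hB : B.IsSymm) (hu : B.IsUnimodular) (he : B.IsEven) {n : ℕ}
    (hn : 3 ≤ n) (hrank : finrank ℤ W = 2 * n) (hsig : B.signature = 0) (φ : B.IsometryEquiv B) :
    IsWordIn {ψ : B.IsometryEquiv B | ∃ α β : B.IsometryEquiv B, ψ = ((β.symm.trans α.symm).trans β).trans α} φ ↔
      φ.IsOrientationPreserving ∧ LinearMap.det (φ : W →ₗ[ℤ] W) = 1 := by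
  obtain ⟨e⟩ := equivalent_hyperbolicSum_of_signature_eq_zero _ hB hu he (by omega) hrank hsig
  exact isWordIn_commutators_iff_of_isometryEquiv_hyperbolicSum hn hB hu.nondegenerate e.symm φ

end EvenUnimodular

end Literature.Topology.FourManifolds

end
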